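import Mathlib
import Literature.RingTheory.MvPolynomial.MultigradedHilbertFunction
import Summits.MatrixMultiplication.MatrixMultiplication.Theorems.FidelityWitnessesFidelityGapThreeSeventeenStubBorelNormalFormRank
import Summits.MatrixMultiplication.MatrixMultiplication.Theorems.FidelityWitnessesFidelityGapThreeSeventeenStubBorelNormalFormOps

/-!
# Borel normal form, part 10: the fat-candidate conditions pass to the limit

Support file for `stub_borelNormalForm` (line `symbolic-square-border-apolarity` of
`FidelityWitnesses.FidelityGapThreeSeventeen`).  A LIMIT PACKAGE (`LimPkg`) is a translate of the
thirteen pieces given through its lattice test `Hb` and the translate `H` on families, with the abstract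
properties (commute with `ε`, preserve the pieces, mutually quasi-inverse on pieces of total degree `≤ 4`,
`Hb` multiplicative up to a power of `ε`, both preserving the apolar annihilator families).  For such a
package EVERY conjunct of `IsFatCandidate T3 17` passes from `I` to `m ↦ lim (I m)` (`good_lim`): exact
codimension (`finrank_limW_eq`), apolarity (the annihilator is a fixed subspace), the incidences
`I_m S_e ≤ I_{m+e}` and all rank upper bounds (room / fat: products and sups are dominated by limits of the
same dimension).  PROVED.
-/

noncomputable section

namespace Summit.MatrixMultiplication.MatrixMultiplication.Theorems.SymbolicSquare

-- single-conjunct summit: the `Summit.<S>.<P>` prefix repeats `MatrixMultiplication` by design (D-0017)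
set_option linter.dupNamespace false

open scoped BigOperators Polynomial
open Polynomial

/-! ## Passage of the fat-candidate conditions to the limit -/

section Good

open BorelLimit

/-- The total degree `|m| = m₀ + m₁ + m₂` of a multidegree. -/
def tot (m : MDeg) : ℕ := m 0 + m 1 + m 2

/-- The pieces `S m` are finite-dimensional. -/
theorem S_finite (m : MDeg) : Module.Finite ℂ (S m) :=
  Literature.RingTheory.MvPolynomial.finite_weightedHomogeneousSubmodule_of_ne_zero (K := ℂ) wt
    (fun v => by simp [wt]) m

/-- `S m · S e ≤ S (m + e)`. -/
theorem S_mul_le (m e : MDeg) : S m * S e ≤ S (m + e) := MvPolynomial.weightedHomogeneousSubmodule_mul wt m e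

/-- **A LIMIT PACKAGE**: a translate of the thirteen pieces (a one-parameter subgroup at `s = 1/ε`) given
through its lattice test `Hb` (quasi-inverse) and `H` (the translate itself) on families `Poly[ε]`, with
the properties that make every fat-candidate condition pass to the limit: both commute with `ε` and
preserve the pieces `S m[ε]`; they are mutually quasi-inverse (`= ε^{a m}`) on the pieces of total
degree `≤ 4`; `Hb` is multiplicative up to `ε^c` on pairs of pieces of total degree `≤ 4`; both
preserve the families of the apolar annihilator `S₁₁₁ ∩ ker ⟨·, T3⟩`. -/
structure LimPkg where
  /-- the lattice test (quasi-inverse of the translate) -/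
  Hb : Poly[X] →ₗ[ℂ] Poly[X]
  /-- the translate -/
  H : Poly[X] →ₗ[ℂ] Poly[X]
  /-- `Hb` commutes with `ε` -/
  hX : ∀ F, Hb (X * F) = X * Hb F
  /-- `H` commutes with `ε` -/
  hXH : ∀ F, H (X * F) = X * H F
  /-- `Hb` preserves the pieces -/
  hbS : ∀ m, ∀ F ∈ famOf (S m), Hb F ∈ famOf (S m)
  /-- `H` preserves the pieces -/
  hHS : ∀ m, ∀ F ∈ famOf (S m), H F ∈ famOf (S m)
  /-- the exponent of the quasi-inverse relation on `S m[ε]` -/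
  a : MDeg → ℕ
  /-- `Hb ∘ H = ε^a` -/
  inv1 : ∀ m, tot m ≤ 4 → ∀ F ∈ famOf (S m), Hb (H F) = X ^ (a m) * F
  /-- `H ∘ Hb = ε^a` -/
  inv2 : ∀ m, tot m ≤ 4 → ∀ F ∈ famOf (S m), H (Hb F) = X ^ (a m) * F
  /-- the exponent of the multiplicativity defect -/
  c : ℕ
  /-- `Hb F · Hb G = ε^c Hb (F G)` -/
  hmul : ∀ m m', tot m + tot m' ≤ 4 → ∀ F ∈ famOf (S m), ∀ G ∈ famOf (S m'), Hb F * Hb G = X ^ c * Hb (F * G)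
  /-- `Hb` preserves the annihilator families -/
  annb : ∀ F ∈ famOf (S m111 ⊓ LinearMap.ker (tPairL T3)), Hb F ∈ famOf (S m111 ⊓ LinearMap.ker (tPairL T3))
  /-- `H` preserves the annihilator families -/
  annH : ∀ F ∈ famOf (S m111 ⊓ LinearMap.ker (tPairL T3)), H F ∈ famOf (S m111 ⊓ LinearMap.ker (tPairL T3))

variable (P : LimPkg) (I : MDeg → Submodule ℂ Poly)

/-- The limit of each piece keeps its dimension. -/
theorem finrank_limW_S (m : MDeg) (hm : tot m ≤ 4) {W : Submodule ℂ Poly} (hW : W ≤ S m) :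
    Module.finrank ℂ (limW P.Hb (S m) W) = Module.finrank ℂ W := by
  haveI := S_finite m
  exact finrank_limW_eq P.Hb P.H P.hX P.hXH hW (P.hHS m) (P.a m) (P.inv1 m hm) (P.inv2 m hm)

/-- (deg) passes to the limit. -/
theorem lim_deg (m : MDeg) (hm : tot m ≤ 4)
    (h : I m ≤ S m ∧ Module.finrank ℂ (I m) + 17 = Module.finrank ℂ (S m)) :
    limW P.Hb (S m) (I m) ≤ S m ∧ Module.finrank ℂ (limW P.Hb (S m) (I m)) + 17 = Module.finrank ℂ (S m) :=
  ⟨limW_le P.Hb, by rw [finrank_limW_S P m hm h.1]; exact h.2⟩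

/-- A piece survives its own limit: `S e ≤ lim S e`. -/
theorem S_le_limW (e : MDeg) : S e ≤ limW P.Hb (S e) (S e) := le_limW_self P.Hb le_rfl (P.hbS e)

/-- Products with a piece are dominated: `lim I · S e ≤ lim (I · S e)`. -/
theorem dom_mulS (m e m₄ : MDeg) (hme : m + e = m₄) (ht : tot m + tot e ≤ 4) :
    limW P.Hb (S m) (I m) * S e ≤ limW P.Hb (S m₄) (I m * S e) :=
  calc limW P.Hb (S m) (I m) * S e ≤ limW P.Hb (S m) (I m) * limW P.Hb (S e) (S e) :=
        mul_le_mul_right (S_le_limW P e) _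
    _ ≤ limW P.Hb (S m₄) (I m * S e) := by
        rw [← hme]
        exact limW_mul_le P.Hb P.c (P.hmul m e ht) (S_mul_le m e)

/-- Products of pieces are dominated: `lim I · lim J ≤ lim (I · J)`. -/
theorem dom_mulI (m₁ m₂ m₄ : MDeg) (hme : m₁ + m₂ = m₄) (ht : tot m₁ + tot m₂ ≤ 4) :
    limW P.Hb (S m₁) (I m₁) * limW P.Hb (S m₂) (I m₂) ≤ limW P.Hb (S m₄) (I m₁ * I m₂) := by
  rw [← hme]
  exact limW_mul_le P.Hb P.c (P.hmul m₁ m₂ ht) (S_mul_le m₁ m₂)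

/-- Sups are dominated. -/
theorem dom_sup (m₄ : MDeg) {A' B' A B : Submodule ℂ Poly} (hA : A' ≤ limW P.Hb (S m₄) A)
    (hB : B' ≤ limW P.Hb (S m₄) B) : A' ⊔ B' ≤ limW P.Hb (S m₄) (A ⊔ B) :=
  (sup_le_sup hA hB).trans (limW_sup_le P.Hb)

/-- `I · S e ≤ S (m + e)`. -/
theorem mulS_le_S (m e m₄ : MDeg) (hme : m + e = m₄) (hIm : I m ≤ S m) : I m * S e ≤ S m₄ := by
  rw [← hme]; exact (mul_le_mul_left hIm _).trans (S_mul_le m e)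

/-- `I · J ≤ S (m₁ + m₂)`. -/
theorem mulI_le_S (m₁ m₂ m₄ : MDeg) (hme : m₁ + m₂ = m₄) (h1 : I m₁ ≤ S m₁) (h2 : I m₂ ≤ S m₂) :
    I m₁ * I m₂ ≤ S m₄ := by
  rw [← hme]; exact (mul_le_mul' h1 h2).trans (S_mul_le m₁ m₂)

/-- **Rank upper bounds pass to the limit**: a dominated subspace has at most the dimension of its
dominator's original. -/
theorem finrank_le_of_dom (m₄ : MDeg) (ht : tot m₄ ≤ 4) {A' A : Submodule ℂ Poly}
    (h1 : A' ≤ limW P.Hb (S m₄) A) (h2 : A ≤ S m₄) : Module.finrank ℂ A' ≤ Module.finrank ℂ A := by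
  haveI := S_finite m₄
  haveI : Module.Finite ℂ (limW P.Hb (S m₄) A) := Module.Finite.of_injective
    (Submodule.inclusion (limW_le P.Hb)) (Submodule.inclusion_injective _)
  rw [← finrank_limW_S P m₄ ht h2]
  exact Submodule.finrank_mono h1

/-- (mult) passes to the limit. -/
theorem lim_mulS (m e m' : MDeg) (hme : m + e = m') (ht : tot m + tot e ≤ 4) (h : I m * S e ≤ I m') :
    limW P.Hb (S m) (I m) * S e ≤ limW P.Hb (S m') (I m') :=
  (dom_mulS P I m e m' hme ht).trans (limW_mono P.Hb h)

/-- The apolar annihilator survives the limit. -/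
theorem limW_ann : limW P.Hb (S m111) (S m111 ⊓ LinearMap.ker (tPairL T3)) = S m111 ⊓ LinearMap.ker (tPairL T3) :=
  limW_eq_self P.Hb inf_le_left P.annb P.H P.annH (P.a m111) (P.inv2 m111 (by decide))

/-- (apolar) passes to the limit. -/
theorem lim_apolar (m : MDeg) (hmc : m + (fun s => 1 - m s) = m111) (ht : tot m + tot (fun s => 1 - m s) ≤ 4)
    (hIm : I m ≤ S m) (h : Apolar T3 m (I m)) : Apolar T3 m (limW P.Hb (S m) (I m)) := by
  intro f hf g hg
  have hle : I m * S (fun s => 1 - m s) ≤ S m111 ⊓ LinearMap.ker (tPairL T3) := by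
    rw [Submodule.mul_le]
    intro f' hf' g' hg'
    refine Submodule.mem_inf.2 ⟨?_, LinearMap.mem_ker.2 (h f' hf' g' hg')⟩
    rw [← hmc]
    exact S_mul_le _ _ (Submodule.mul_mem_mul (hIm hf') hg')
  have hfg : f * g ∈ limW P.Hb (S m111) (I m * S (fun s => 1 - m s)) :=
    dom_mulS P I m _ m111 hmc ht (Submodule.mul_mem_mul hf hg)
  have := (limW_mono P.Hb hle) hfg
  rw [limW_ann P] at this
  exact LinearMap.mem_ker.1 (Submodule.mem_inf.1 this).2

/-- **Every fat-candidate condition passes to the limit of a limit package.** -/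
theorem good_lim (hI : IsFatCandidate T3 17 I) : IsFatCandidate T3 17 (fun m => limW P.Hb (S m) (I m)) := by
  obtain ⟨hdeg, ⟨hap1, hap2, hap3, hap4⟩, ⟨hm1, hm2, hm3, hm4, hm5, hm6, hm7, hm8, hm9, hm10, hm11, hm12, hm13, hm14, hm15⟩,
    ⟨hr1, hr2, hr3, hr4, hr5, hr6, hr7, hr8, hr9, hr10, hr11, hr12⟩,
    ⟨hf1, hf2, hf3, hf4, hf5, hf6, hf7, hf8, hf9, hf10, hf11, hf12⟩⟩ := hI
  have hS : ∀ m ∈ degsData, I m ≤ S m := fun m hm => (hdeg m hm).1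
  have h110 := hS m110 (by simp [degsData]); have h101 := hS m101 (by simp [degsData])
  have h011 := hS m011 (by simp [degsData]); have h200 := hS m200 (by simp [degsData])
  have h020 := hS m020 (by simp [degsData]); have h002 := hS m002 (by simp [degsData])
  have h210 := hS m210 (by simp [degsData]); have h120 := hS m120 (by simp [degsData])
  have h201 := hS m201 (by simp [degsData]); have h102 := hS m102 (by simp [degsData])
  have h021 := hS m021 (by simp [degsData]); have h012 := hS m012 (by simp [degsData])
  have h111 := hS m111 (by simp [degsData])
  -- rank monotonicity helpers
  have R1 : ∀ (m e m₄ : MDeg), m + e = m₄ → tot m + tot e ≤ 4 → tot m₄ ≤ 4 → I m ≤ S m →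
      Module.finrank ℂ ↥(limW P.Hb (S m) (I m) * S e) ≤ Module.finrank ℂ ↥(I m * S e) :=
    fun m e m₄ hme ht ht4 hIm =>
      finrank_le_of_dom P m₄ ht4 (dom_mulS P I m e m₄ hme ht) (mulS_le_S I m e m₄ hme hIm)
  have R2 : ∀ (m₁ e₁ m₂ e₂ m₄ : MDeg), m₁ + e₁ = m₄ → m₂ + e₂ = m₄ → tot m₁ + tot e₁ ≤ 4 → tot m₂ + tot e₂ ≤ 4 →
      tot m₄ ≤ 4 → I m₁ ≤ S m₁ → I m₂ ≤ S m₂ →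
      Module.finrank ℂ ↥(limW P.Hb (S m₁) (I m₁) * S e₁ ⊔ limW P.Hb (S m₂) (I m₂) * S e₂) ≤
        Module.finrank ℂ ↥(I m₁ * S e₁ ⊔ I m₂ * S e₂) :=
    fun m₁ e₁ m₂ e₂ m₄ h1 h2 t1 t2 t4 i1 i2 =>
      finrank_le_of_dom P m₄ t4 (dom_sup P m₄ (dom_mulS P I m₁ e₁ m₄ h1 t1) (dom_mulS P I m₂ e₂ m₄ h2 t2))
        (sup_le (mulS_le_S I m₁ e₁ m₄ h1 i1) (mulS_le_S I m₂ e₂ m₄ h2 i2))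
  have R3 : ∀ (m₁ e₁ m₂ e₂ m₃ e₃ m₄ : MDeg), m₁ + e₁ = m₄ → m₂ + e₂ = m₄ → m₃ + e₃ = m₄ →
      tot m₁ + tot e₁ ≤ 4 → tot m₂ + tot e₂ ≤ 4 → tot m₃ + tot e₃ ≤ 4 → tot m₄ ≤ 4 →
      I m₁ ≤ S m₁ → I m₂ ≤ S m₂ → I m₃ ≤ S m₃ →
      Module.finrank ℂ ↥(limW P.Hb (S m₁) (I m₁) * S e₁ ⊔ limW P.Hb (S m₂) (I m₂) * S e₂ ⊔
        limW P.Hb (S m₃) (I m₃) * S e₃) ≤ Module.finrank ℂ ↥(I m₁ * S e₁ ⊔ I m₂ * S e₂ ⊔ I m₃ * S e₃) :=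
    fun m₁ e₁ m₂ e₂ m₃ e₃ m₄ h1 h2 h3 t1 t2 t3 t4 i1 i2 i3 =>
      finrank_le_of_dom P m₄ t4
        (dom_sup P m₄ (dom_sup P m₄ (dom_mulS P I m₁ e₁ m₄ h1 t1) (dom_mulS P I m₂ e₂ m₄ h2 t2))
          (dom_mulS P I m₃ e₃ m₄ h3 t3))
        (sup_le (sup_le (mulS_le_S I m₁ e₁ m₄ h1 i1) (mulS_le_S I m₂ e₂ m₄ h2 i2)) (mulS_le_S I m₃ e₃ m₄ h3 i3))
  have F1 : ∀ (m₁ m₂ m₄ : MDeg), m₁ + m₂ = m₄ → tot m₁ + tot m₂ ≤ 4 → tot m₄ ≤ 4 → I m₁ ≤ S m₁ → I m₂ ≤ S m₂ →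
      Module.finrank ℂ ↥(limW P.Hb (S m₁) (I m₁) * limW P.Hb (S m₂) (I m₂)) ≤ Module.finrank ℂ ↥(I m₁ * I m₂) :=
    fun m₁ m₂ m₄ h t t4 i1 i2 =>
      finrank_le_of_dom P m₄ t4 (dom_mulI P I m₁ m₂ m₄ h t) (mulI_le_S I m₁ m₂ m₄ h i1 i2)
  have F2 : ∀ (m₁ m₂ m₃ m₅ m₄ : MDeg), m₁ + m₂ = m₄ → m₃ + m₅ = m₄ → tot m₁ + tot m₂ ≤ 4 → tot m₃ + tot m₅ ≤ 4 →
      tot m₄ ≤ 4 → I m₁ ≤ S m₁ → I m₂ ≤ S m₂ → I m₃ ≤ S m₃ → I m₅ ≤ S m₅ →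
      Module.finrank ℂ ↥(limW P.Hb (S m₁) (I m₁) * limW P.Hb (S m₂) (I m₂) ⊔
        limW P.Hb (S m₃) (I m₃) * limW P.Hb (S m₅) (I m₅)) ≤ Module.finrank ℂ ↥(I m₁ * I m₂ ⊔ I m₃ * I m₅) :=
    fun m₁ m₂ m₃ m₅ m₄ h1 h2 t1 t2 t4 i1 i2 i3 i5 =>
      finrank_le_of_dom P m₄ t4 (dom_sup P m₄ (dom_mulI P I m₁ m₂ m₄ h1 t1) (dom_mulI P I m₃ m₅ m₄ h2 t2))
        (sup_le (mulI_le_S I m₁ m₂ m₄ h1 i1 i2) (mulI_le_S I m₃ m₅ m₄ h2 i3 i5))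
  refine ⟨?_, ⟨?_, ?_, ?_, ?_⟩, ⟨?_, ?_, ?_, ?_, ?_, ?_, ?_, ?_, ?_, ?_, ?_, ?_, ?_, ?_, ?_⟩,
    ⟨?_, ?_, ?_, ?_, ?_, ?_, ?_, ?_, ?_, ?_, ?_, ?_⟩, ⟨?_, ?_, ?_, ?_, ?_, ?_, ?_, ?_, ?_, ?_, ?_, ?_⟩⟩
  -- (deg)
  · intro m hm
    have htot : tot m ≤ 4 := by
      simp only [degsData, List.mem_cons, List.mem_nil_iff, or_false] at hm
      rcases hm with rfl | rfl | rfl | rfl | rfl | rfl | rfl | rfl | rfl | rfl | rfl | rfl | rfl <;> decide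
    exact lim_deg P I m htot (hdeg m hm)
  -- (apolar)
  · exact lim_apolar P I m110 (by decide) (by decide) h110 hap1
  · exact lim_apolar P I m101 (by decide) (by decide) h101 hap2
  · exact lim_apolar P I m011 (by decide) (by decide) h011 hap3
  · exact lim_apolar P I m111 (by decide) (by decide) h111 hap4
  -- (mult)
  · exact lim_mulS P I m110 e0 m210 (by decide) (by decide) hm1
  · exact lim_mulS P I m110 e1 m120 (by decide) (by decide) hm2
  · exact lim_mulS P I m110 e2 m111 (by decide) (by decide) hm3
  · exact lim_mulS P I m101 e0 m201 (by decide) (by decide) hm4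
  · exact lim_mulS P I m101 e1 m111 (by decide) (by decide) hm5
  · exact lim_mulS P I m101 e2 m102 (by decide) (by decide) hm6
  · exact lim_mulS P I m011 e0 m111 (by decide) (by decide) hm7
  · exact lim_mulS P I m011 e1 m021 (by decide) (by decide) hm8
  · exact lim_mulS P I m011 e2 m012 (by decide) (by decide) hm9
  · exact lim_mulS P I m200 e1 m210 (by decide) (by decide) hm10
  · exact lim_mulS P I m200 e2 m201 (by decide) (by decide) hm11
  · exact lim_mulS P I m020 e0 m120 (by decide) (by decide) hm12
  · exact lim_mulS P I m020 e2 m021 (by decide) (by decide) hm13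
  · exact lim_mulS P I m002 e0 m102 (by decide) (by decide) hm14
  · exact lim_mulS P I m002 e1 m012 (by decide) (by decide) hm15
  -- (room)
  · exact (Nat.add_le_add_right (R1 m210 e0 m310 (by decide) (by decide) (by decide) h210) 17).trans hr1
  · exact (Nat.add_le_add_right (R1 m120 e1 m130 (by decide) (by decide) (by decide) h120) 17).trans hr2
  · exact (Nat.add_le_add_right (R1 m201 e0 m301 (by decide) (by decide) (by decide) h201) 17).trans hr3
  · exact (Nat.add_le_add_right (R1 m102 e2 m103 (by decide) (by decide) (by decide) h102) 17).trans hr4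
  · exact (Nat.add_le_add_right (R1 m021 e1 m031 (by decide) (by decide) (by decide) h021) 17).trans hr5
  · exact (Nat.add_le_add_right (R1 m012 e2 m013 (by decide) (by decide) (by decide) h012) 17).trans hr6
  · exact (Nat.add_le_add_right (R2 m210 e1 m120 e0 m220 (by decide) (by decide) (by decide) (by decide)
      (by decide) h210 h120) 17).trans hr7
  · exact (Nat.add_le_add_right (R2 m201 e2 m102 e0 m202 (by decide) (by decide) (by decide) (by decide)
      (by decide) h201 h102) 17).trans hr8
  · exact (Nat.add_le_add_right (R2 m021 e2 m012 e1 m022 (by decide) (by decide) (by decide) (by decide)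
      (by decide) h021 h012) 17).trans hr9
  · exact (Nat.add_le_add_right (R3 m210 e2 m201 e1 m111 e0 m211 (by decide) (by decide) (by decide) (by decide)
      (by decide) (by decide) (by decide) h210 h201 h111) 17).trans hr10
  · exact (Nat.add_le_add_right (R3 m120 e2 m021 e0 m111 e1 m121 (by decide) (by decide) (by decide) (by decide)
      (by decide) (by decide) (by decide) h120 h021 h111) 17).trans hr11
  · exact (Nat.add_le_add_right (R3 m102 e1 m012 e0 m111 e2 m112 (by decide) (by decide) (by decide) (by decide)
      (by decide) (by decide) (by decide) h102 h012 h111) 17).trans hr12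
  -- (fat)
  · exact (Nat.add_le_add_right (F1 m200 m110 m310 (by decide) (by decide) (by decide) h200 h110) _).trans hf1
  · exact (Nat.add_le_add_right (F1 m020 m110 m130 (by decide) (by decide) (by decide) h020 h110) _).trans hf2
  · exact (Nat.add_le_add_right (F1 m200 m101 m301 (by decide) (by decide) (by decide) h200 h101) _).trans hf3
  · exact (Nat.add_le_add_right (F1 m002 m101 m103 (by decide) (by decide) (by decide) h002 h101) _).trans hf4
  · exact (Nat.add_le_add_right (F1 m020 m011 m031 (by decide) (by decide) (by decide) h020 h011) _).trans hf5
  · exact (Nat.add_le_add_right (F1 m002 m011 m013 (by decide) (by decide) (by decide) h002 h011) _).trans hf6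
  · exact (Nat.add_le_add_right (F2 m110 m110 m200 m020 m220 (by decide) (by decide) (by decide) (by decide)
      (by decide) h110 h110 h200 h020) _).trans hf7
  · exact (Nat.add_le_add_right (F2 m101 m101 m200 m002 m202 (by decide) (by decide) (by decide) (by decide)
      (by decide) h101 h101 h200 h002) _).trans hf8
  · exact (Nat.add_le_add_right (F2 m011 m011 m020 m002 m022 (by decide) (by decide) (by decide) (by decide)
      (by decide) h011 h011 h020 h002) _).trans hf9
  · exact (Nat.add_le_add_right (F2 m110 m101 m200 m011 m211 (by decide) (by decide) (by decide) (by decide)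
      (by decide) h110 h101 h200 h011) _).trans hf10
  · exact (Nat.add_le_add_right (F2 m110 m011 m020 m101 m121 (by decide) (by decide) (by decide) (by decide)
      (by decide) h110 h011 h020 h101) _).trans hf11
  · exact (Nat.add_le_add_right (F2 m101 m011 m002 m110 m112 (by decide) (by decide) (by decide) (by decide)
      (by decide) h101 h011 h002 h110) _).trans hf12

end Good


/-- **Part 10 of `stub_borelNormalForm` (registered helper stub): every fat-candidate condition passes to
the limit of a limit package.** -/
theorem stub_borelNormalForm_good : ∀ (P : LimPkg) (I : MDeg → Submodule ℂ Poly),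
    IsFatCandidate T3 17 I → IsFatCandidate T3 17 (fun m => BorelLimit.limW P.Hb (S m) (I m)) :=
  fun P I hI => good_lim P I hI

end Summit.MatrixMultiplication.MatrixMultiplication.Theorems.SymbolicSquare

end
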